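import Literature.MathematicalPhysics.QuantumFieldTheory.Balaban1983to89.Node00.CarriersB8SubB
import Literature.MathematicalPhysics.QuantumFieldTheory.Balaban1983to89.B8LeafModelZd3H

/-!
# NODE 00 (YM-PLAN Track A) — STAGE 3′(X.B8″H): THE [Balaban1985RegularSpaces] SUB-FAMILY PIN ON THE REPAIRED CARRIER — the [B8] group of record over
# n05-c's four-law sub-index `IdxB8SubB θ` with its members read at `B8LeafModelZd3H.zdGF3H` (Theorem 8's source space AS PRINTED: «f a Lie-algebra valued
# function defined on Ω₀, from R(U₀), |f|₍₋₂₎ finite»), the surviving leaf over it (`B8LeafOfRecordSubBH`), its reading as «the EIGHT non-Theorem-8 conjuncts of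
# the old pin ∧ Theorem 8 surviving at the repaired members», the carrier law, the cut layer, and the rejection of the two refuting sources of record

[Balaban1985RegularSpaces] = T. Bałaban, *Spaces of regular gauge field configurations on a lattice and gauge fixing conditions*, Commun. Math. Phys. **99**
(1985) 75–102 — Lemma 1 p. 79, Thm 2 p. 83, Prop. 3 p. 87, Thm 4 p. 88, Props. 5–7 pp. 94–100, Thm 8 p. 101 («Let us define the function f ∈ R(U₀) … f is a
𝔤-valued function defined on Ω₀», (1.146)); the norm |f|₍₋₂₎ p. 86 (definition after (1.55)).  PDF held: `paper:balaban1985-cmp99-regular-spaces-gauge-fixing`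
(journal page = PDF page + 74).

WHY THIS MODULE (seat `pub-ymgap-dag-n05-c` g6, 2026-08-27; APPEND-ONLY: a NEW importing module — dag-n05-d g4's `Node00/CarriersB8SubB`, this seat's
`B8LeafModelZd3H` and everything below them are untouched and CONSUMED BY NAME).  This seat's g5 kernel certificates
`B8LeafModelZd3SourceReality.not_b8LeafOfRecordSubB` (p501857) and `B8LeafModelZd3SourceBounded.thm8Surviving_fails_hermitian_unbounded_source_famB8OfRecordSubB` (p503878)
show that the [B8″] slot of record `Node00.B8LeafOfRecordSubB θ λ` is UNINHABITED for every admissible `θ` (`θ.D ≥ 2`) and EVERY residual layer `λ`: its Theorem-8 conjunct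
`t8 := B8Thm8Surviving.Thm8SurvivingAt 1 λ.B₁ λ.B₂ (famB8OfRecordSubB θ λ.β λ.len ·)` reads the source space of n05-a's carrier `zdGF3` (`Src := Site d → 𝔸`, `InR := InR138`,
`fNorm := msup`), which admits NON-Hermitian sources (print: «𝔤-valued») and UNBOUNDED ones with junk norm `0` (print: |f|₍₋₂₎ is a supremum), and Theorem 8's sentence is
false for both.  The repair is in the tree as the carrier `B8LeafModelZd3H.zdGF3H` (p504278: `zdGF3` with the ONE field `InR` replaced by «`InR138 ∧ (∀ x, f x Hermitian) ∧
(f = 0 off Ω₀) ∧ Bdd`», every other field `rfl`-equal), the honest Theorem-8 assembly over it (`B8Thm8SurvivingZd3H.thm8SurvivingAt_zd3H_univ_lan` p505395, dag-n05-d's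
ι-generic `B8Thm8SurvivingZd3MapH` p506615) and the sourced sockets' providers (dag-n05-d g5).  What the N05 line lacked is THE PIN: the [B8] group of record READ AT THE
REPAIRED MEMBERS.  This file types it — letter for letter dag-n05-d g4's `CarriersB8SubB` §1–§3 with `famB8OfRecordSubB ↦ famB8OfRecordSubBH` — and records the one
fact every consumer needs: **the repaired leaf is the EIGHT non-Theorem-8 conjuncts of the OLD pin (unchanged statements, so every landed supplier of `l1 ∕ t2 ∕ p3 ∕ t4 ∕
p5e ∕ p5u ∕ p6 ∕ p7` over `famB8OfRecordSubB` transfers by `exact`) together with Theorem 8 surviving AT THE REPAIRED MEMBERS** (`b8LeafOfRecordSubBH_iff_subB_and_t8H`).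

* §1 `famB8OfRecordSubBH θ β len i := zdGF3H θ.𝔸 θ.L β len i.1.1` (SAME index `IdxB8SubB θ`); its `GFData2` ∕ `GFData` ∕ (1.140) faces ARE the old pin's (`rfl`);
  the R-extension law `proj140` and the carrier law (1.36) ⊂ (1.62) on it (g31's proofs BY NAME — neither reads `InR`).
* §2 **`PrintedCarriersR.withB8OfRecordSubBH X θ λ`** — `withB8OfRecordSubB` VERBATIM with the family ↦ `famB8OfRecordSubBH` (SAME residual layer `λ : ResidB8 θ`;
  Proposition 7's axial map `fun j => λ.toAxial j.1` typechecks unchanged: the repaired members' `Cfg` ∕ `Pert` are the old ones by `rfl`);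
  **`B8LeafOfRecordSubBH θ λ`** — the surviving leaf `B8LeafRS` over the repaired sub-family; `b8LeafRS_withB8OfRecordSubBH_iff` (`Iff.rfl`); the `rfl` commuting faces.
* §3 THE READING: `b8LeafOfRecordSubBH_iff_subB_and_t8H` and the constructor `b8LeafOfRecordSubBH_of_subB_fields`; OLD ⇒ NEW `b8LeafOfRecordSubBH_of_b8LeafOfRecordSubB`
  (the repaired membership is STRONGER, so the old Theorem-8 conjunct implies the new one; recorded for the lattice of pins — vacuous today since the old slot is
  empty); typed ⇒ surviving `b8LeafOfRecordSubBH_of_b8LeafR`.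
* §4 THE CUT LAYER (dag-n05-d's `ResidB8.cutSubB`, REUSED — no new definition): `b8LeafOfRecordSubBH_cutSubB_iff` (`Iff.rfl`) = the conclusion shape of the knits of
  record with `t8` read at the repaired members.
* §5 NON-VACUITY OF THE REPAIR AT THE PIN: the index is inhabited; the two refuting sources of record are REJECTED by the repaired membership at every member of the
  pin (`not_inR_famB8OfRecordSubBH_of_not_isSelfAdjoint`, `…_of_not_bdd`), and `f = 0` is admitted (`inR_famB8OfRecordSubBH_zero`) — so neither g5 certificate
  applies to `B8LeafOfRecordSubBH`, and the Theorem-8 binder is not emptied.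

HONEST FRAMING: DEFINITIONS and `rfl` ∕ by-name bookkeeping only — nothing of [Balaban1985RegularSpaces] is asserted or discharged here; whether Theorem 8 surviving
HOLDS at the repaired members is the assembly's theorem modulo its displayed sockets (p505395 ∕ p506615), not claimed; N05 NOT discharged; counts unmoved; one finite
T⁴ programme at fixed ε, Bałaban as printed — NOT continuum ∕ ℝ⁴ ∕ infinite volume ∕ OS ∕ mass gap ∕ Clay.  No `sorry`, no `axiom`, no `opaque`, no `instance`, no `notation`. -/

noncomputable section

namespace Literature.MathematicalPhysics.QuantumFieldTheory.Balaban1983to89.Node00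

open DagBinding
open B8LeafKnitRS (B8LeafRS)
open B8LeafModelZd (ZdIdx)
open B8LeafModelZd3 (zdGF3)
open B8LeafModelZd3H (zdGF3H)
open B8Lemma1NonAbelian (blockPairNA)
open B8IdxB8LawsB (IdxB8LawsB IdxB8SubB famB8OfRecordSubB)

/-! ## §1. The [B8] sub-family of record READ AT THE REPAIRED MEMBERS; its `rfl` faces; the two carrier laws -/

section FamilyH

variable (θ : Stage3Params)

/-- **THE [B8] SUB-FAMILY OF RECORD AT THE REPAIRED MEMBERS**: member `i` of n05-c's four-law sub-index `IdxB8SubB θ` ↦ `zdGF3H θ.𝔸 θ.L β len i.1.1` — n05-a's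
member of record with Theorem 8's source space read as printed («f ∈ R(U₀), 𝔤-valued, defined on Ω₀, |f|₍₋₂₎ finite»); every other carrier and predicate of the member
unchanged. [cite: Balaban1985RegularSpaces, Thm 8 (1.146) p.101, (1.27) p.80, p.86 (definition after (1.55)); (1.33)–(1.40) pp.82–83, (1.62) p.87, (1.66) p.88, (1.140) p.100] -/
def famB8OfRecordSubBH (β : ℝ) (len : B7Prop1Explicit.Site θ.D → ℝ) (i : IdxB8SubB θ) : B8SectGH.GFData3 :=
  zdGF3H θ.𝔸 θ.L β len i.1.1

variable {θ}

/-- The repaired member's `GFData2` part (Lemma 1 – Prop. 6 carriers and predicates) IS the old pin's (`rfl`).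
[cite: Balaban1985RegularSpaces, (1.33)–(1.40) pp.82–83 (bookkeeping)] -/
theorem famB8OfRecordSubBH_toGFData2 (β : ℝ) (len : B7Prop1Explicit.Site θ.D → ℝ) (i : IdxB8SubB θ) :
    (famB8OfRecordSubBH θ β len i).toGFData2 = (famB8OfRecordSubB θ β len i).toGFData2 := rfl

/-- The repaired member's `GFData` part (Theorems 2 ∕ 4 carriers and predicates) IS the old pin's (`rfl`). [cite: Balaban1985RegularSpaces, (1.33)–(1.39) p.82 (bookkeeping)] -/
theorem famB8OfRecordSubBH_toGFData (β : ℝ) (len : B7Prop1Explicit.Site θ.D → ℝ) (i : IdxB8SubB θ) :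
    (famB8OfRecordSubBH θ β len i).toGFData = (famB8OfRecordSubB θ β len i).toGFData := rfl

/-- (1.140) at the repaired member IS the old pin's (`rfl`). [cite: Balaban1985RegularSpaces, (1.140) p.100 (bookkeeping)] -/
theorem famB8OfRecordSubBH_C140 (β : ℝ) (len : B7Prop1Explicit.Site θ.D → ℝ) (i : IdxB8SubB θ) :
    (famB8OfRecordSubBH θ β len i).C140 = (famB8OfRecordSubB θ β len i).C140 := rfl

/-- (1.146) `LandauF` at the repaired member IS the old pin's (`rfl`). [cite: Balaban1985RegularSpaces, (1.146) p.101 (bookkeeping)] -/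
theorem famB8OfRecordSubBH_LandauF (β : ℝ) (len : B7Prop1Explicit.Site θ.D → ℝ) (i : IdxB8SubB θ) :
    (famB8OfRecordSubBH θ β len i).LandauF = (famB8OfRecordSubB θ β len i).LandauF := rfl

/-- The repaired member unfolded to n05-a's carrier of record through `Subtype.val` twice (`rfl`). [cite: Balaban1985RegularSpaces, p.77 (bookkeeping)] -/
theorem famB8OfRecordSubBH_eq (β : ℝ) (len : B7Prop1Explicit.Site θ.D → ℝ) (i : IdxB8SubB θ) :
    famB8OfRecordSubBH θ β len i = zdGF3H θ.𝔸 θ.L β len i.1.1 := rfl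

/-- **The repaired membership «f ∈ R(U₀)» at a member of the pin, unfolded** (`Iff.rfl`): `InR138` ∧ Hermitian values ∧ `f = 0` off `Ω₀` ∧ bounded weighted family.
[cite: Balaban1985RegularSpaces, Thm 8 (1.146) p.101, (1.27) p.80, p.86] -/
theorem inR_famB8OfRecordSubBH_iff (β : ℝ) (len : B7Prop1Explicit.Site θ.D → ℝ) (i : IdxB8SubB θ) (U₀ : (famB8OfRecordSubBH θ β len i).Cfg)
    (f : B7Prop1Explicit.Site θ.D → θ.𝔸) :
    (famB8OfRecordSubBH θ β len i).InR U₀ f ↔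
      B8Eq138LandauZd.InR138 θ.L i.1.1.k i.1.1.η (i.1.1.Ω 0) (i.1.1.Λs i.1.1.k) U₀.1 f ∧ (∀ x, IsSelfAdjoint (f x)) ∧ (∀ x, x ∉ i.1.1.Ω 0 → f x = 0) ∧
        B8ScaledSupNorm.Bdd θ.L i.1.1.k i.1.1.η (-(2 : ℝ)) (fun j (x : B7Prop1Explicit.Site θ.D) => x ∈ i.1.1.Ω j) f :=
  Iff.rfl

/-- OLD ⇐ NEW at the membership: the repaired «f ∈ R(U₀)» implies the old pin's (its first clause). [cite: Balaban1985RegularSpaces, (1.146) p.101 (bookkeeping)] -/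
theorem inR_famB8OfRecordSubB_of_inR_famB8OfRecordSubBH (β : ℝ) (len : B7Prop1Explicit.Site θ.D → ℝ) (i : IdxB8SubB θ)
    (U₀ : (famB8OfRecordSubBH θ β len i).Cfg) (f : B7Prop1Explicit.Site θ.D → θ.𝔸) (h : (famB8OfRecordSubBH θ β len i).InR U₀ f) :
    (famB8OfRecordSubB θ β len i).InR U₀ f :=
  h.1

/-- **THE R-EXTENSION LAW `proj140` HOLDS AT THE REPAIRED MEMBERS** (g31's `proj140_famB8OfRecord` BY NAME: it reads (1.140) and (1.62) only, both unchanged).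
[cite: Balaban1985RegularSpaces, (1.140) p.100, (1.62) p.87] -/
theorem proj140_famB8OfRecordSubBH (β : ℝ) (len : B7Prop1Explicit.Site θ.D → ℝ) (i : IdxB8SubB θ) (α₂ : ℝ) (U₀ : (famB8OfRecordSubBH θ β len i).Cfg)
    (U₁ : (famB8OfRecordSubBH θ β len i).Pert) (h : (famB8OfRecordSubBH θ β len i).C140 α₂ U₀ U₁) : (famB8OfRecordSubBH θ β len i).C162 1 α₂ U₀ U₁ :=
  proj140_famB8OfRecord β len i.1 α₂ U₀ U₁ h

/-- **THE CARRIER LAW (1.36) ⊂ (1.62) HOLDS AT THE REPAIRED MEMBERS** (g31's `C136_C162_famB8OfRecord` BY NAME; the law under which the typed leaf implies the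
surviving one). [cite: Balaban1985RegularSpaces, (1.36) p.82, (1.62) p.87] -/
theorem C136_C162_famB8OfRecordSubBH (β : ℝ) (len : B7Prop1Explicit.Site θ.D → ℝ) (i : IdxB8SubB θ) (b b₂ s : ℝ) (U₀ : (famB8OfRecordSubBH θ β len i).Cfg)
    (U₁ : (famB8OfRecordSubBH θ β len i).Pert) (h : (famB8OfRecordSubBH θ β len i).C136 b b₂ s U₀ U₁) : (famB8OfRecordSubBH θ β len i).C162 b s U₀ U₁ :=
  C136_C162_famB8OfRecord β len i.1 b b₂ s U₀ U₁ h

end FamilyH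

/-! ## §2. The [B8] group of record on the repaired carrier, substituted into a bundle; the surviving leaf over it; `rfl` faces -/

section SubIndexBH

variable {θ : Stage3Params}

/-- **THE [B8] GROUP OF RECORD OVER THE FOUR-LAW SUB-INDEX, READ AT THE REPAIRED MEMBERS, substituted into a carrier bundle**: dag-n05-d's `withB8OfRecordSubB`
VERBATIM with the family `famB8OfRecordSubB ↦ famB8OfRecordSubBH` (index `I8b := IdxB8SubB θ`, R-extension read at the repaired members, Proposition 7's axial map
through `Subtype.val`; SAME residual layer `lam : ResidB8 θ`); every other group of `X` unchanged.
[cite: Balaban1985RegularSpaces, Lemma 1 p.79 – Thm 8 p.101 (the carriers of the typed statements); (1.146) p.101, p.86 (the repaired source space)] -/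
def _root_.Literature.MathematicalPhysics.QuantumFieldTheory.Balaban1983to89.DagBinding.PrintedCarriersR.withB8OfRecordSubBH (X : PrintedCarriersR)
    (θ : Stage3Params) (lam : ResidB8 θ) : PrintedCarriersR :=
  { X with
    I8a := B7Prop1Explicit.Site θ.D × Fin θ.D, I8b := IdxB8SubB θ, I8c := lam.I8c, I8d := lam.I8d, d8 := θ.D, L8 := θ.L,
    C₂ := lam.C₂, B₁' := lam.B₁', B₀' := lam.inp.B₀', B₁ := lam.B₁, B₂ := lam.B₂, c₁ := lam.c₁, inp8 := lam.inp, B₀β := lam.B₀β,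
    loc8 := blockPairNA θ.D θ.L θ.𝔸, fam8 := fun i => (famB8OfRecordSubBH θ lam.β lam.len i).toGFData2, lan8 := lam.lan, cub8 := lam.cub,
    toAxial8 := fun i => lam.toAxial i.1,
    C140 := fun i => (famB8OfRecordSubBH θ lam.β lam.len i).C140, InR := fun i => (famB8OfRecordSubBH θ lam.β lam.len i).InR,
    proj140 := fun i α₂ U₀ U₁ h => proj140_famB8OfRecordSubBH lam.β lam.len i α₂ U₀ U₁ h }

/-- **THE `b8` LEAF AT THE GROUP OF RECORD ON THE REPAIRED CARRIER, IN ITS SURVIVING FORM, OVER THE FOUR-LAW SUB-FAMILY** (Lemma 1 p. 79, Thm 2 p. 83, Prop. 3 p. 87,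
Thm 4 p. 88, Prop. 5 p. 94, Prop. 6 p. 99, Prop. 7 p. 100 faithful, Thm 8 p. 101 surviving at γ = 1 WITH ITS SOURCE SPACE AS PRINTED).
[cite: Balaban1985RegularSpaces, Lemma 1 p.79, Thm 2 p.83, Prop. 3 p.87, Thm 4 p.88, Prop. 5 p.94, Prop. 6 p.99, Prop. 7 p.100, Thm 8 (1.146) p.101 (surviving form, GAPS G-B8-13; source space p.101 + p.86)] -/
def B8LeafOfRecordSubBH (θ : Stage3Params) (lam : ResidB8 θ) : Prop :=
  B8LeafRS θ.D (θ.L : ℝ) lam.C₂ lam.B₁' lam.inp.B₀' lam.B₁ lam.B₂ lam.c₁ lam.inp lam.B₀β (blockPairNA θ.D θ.L θ.𝔸)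
    (fun j : IdxB8SubB θ => famB8OfRecordSubBH θ lam.β lam.len j) lam.lan lam.cub (fun j => lam.toAxial j.1)

/-- The surviving leaf over the SUBSTITUTED bundle's own [B8] group IS `B8LeafOfRecordSubBH θ lam` (`Iff.rfl`). [cite: Balaban1985RegularSpaces, Lemma 1 – Thm 8 pp.79–101 (bookkeeping)] -/
theorem b8LeafRS_withB8OfRecordSubBH_iff (X : PrintedCarriersR) (θ : Stage3Params) (lam : ResidB8 θ) :
    B8LeafRS (X.withB8OfRecordSubBH θ lam).d8 (X.withB8OfRecordSubBH θ lam).L8 (X.withB8OfRecordSubBH θ lam).C₂ (X.withB8OfRecordSubBH θ lam).B₁'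
        (X.withB8OfRecordSubBH θ lam).B₀' (X.withB8OfRecordSubBH θ lam).B₁ (X.withB8OfRecordSubBH θ lam).B₂ (X.withB8OfRecordSubBH θ lam).c₁
        (X.withB8OfRecordSubBH θ lam).inp8 (X.withB8OfRecordSubBH θ lam).B₀β (X.withB8OfRecordSubBH θ lam).loc8 (X.withB8OfRecordSubBH θ lam).fam8R
        (X.withB8OfRecordSubBH θ lam).lan8 (X.withB8OfRecordSubBH θ lam).cub8 (X.withB8OfRecordSubBH θ lam).toAxial8 ↔
      B8LeafOfRecordSubBH θ lam :=
  Iff.rfl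

/-- The [B8] substitution on the repaired carrier AS TYPED (`DagBinding.B8LeafR` over the substituted bundle's own group) unfolded (`Iff.rfl`).
[cite: Balaban1985RegularSpaces, Lemma 1 – Thm 8 pp.79–101 (bookkeeping)] -/
theorem b8LeafR_withB8OfRecordSubBH_iff (X : PrintedCarriersR) (θ : Stage3Params) (lam : ResidB8 θ) :
    B8LeafR (X.withB8OfRecordSubBH θ lam).d8 (X.withB8OfRecordSubBH θ lam).L8 (X.withB8OfRecordSubBH θ lam).C₂ (X.withB8OfRecordSubBH θ lam).B₁'
        (X.withB8OfRecordSubBH θ lam).B₀' (X.withB8OfRecordSubBH θ lam).B₁ (X.withB8OfRecordSubBH θ lam).B₂ (X.withB8OfRecordSubBH θ lam).c₁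
        (X.withB8OfRecordSubBH θ lam).inp8 (X.withB8OfRecordSubBH θ lam).B₀β (X.withB8OfRecordSubBH θ lam).loc8 (X.withB8OfRecordSubBH θ lam).fam8R
        (X.withB8OfRecordSubBH θ lam).lan8 (X.withB8OfRecordSubBH θ lam).cub8 (X.withB8OfRecordSubBH θ lam).toAxial8 ↔
      B8LeafR θ.D (θ.L : ℝ) lam.C₂ lam.B₁' lam.inp.B₀' lam.B₁ lam.B₂ lam.c₁ lam.inp lam.B₀β (blockPairNA θ.D θ.L θ.𝔸)
        (fun j : IdxB8SubB θ => famB8OfRecordSubBH θ lam.β lam.len j) lam.lan lam.cub (fun j => lam.toAxial j.1) :=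
  Iff.rfl

/-- The substitution does not touch the [B10] group (`rfl`) … [cite: Balaban1985UV3, (1)–(5) p.256 (bookkeeping)] -/
theorem withB8OfRecordSubBH_runs10 (X : PrintedCarriersR) (θ : Stage3Params) (lam : ResidB8 θ) : (X.withB8OfRecordSubBH θ lam).runs10 = X.runs10 := rfl

/-- … nor the [B12 §§2–5] group (`rfl` ×2) … [cite: Balaban1987RG1, Lemma 4 p.280 (bookkeeping)] -/
theorem withB8OfRecordSubBH_F12_c12 (X : PrintedCarriersR) (θ : Stage3Params) (lam : ResidB8 θ) :
    (X.withB8OfRecordSubBH θ lam).F12 = X.F12 ∧ (X.withB8OfRecordSubBH θ lam).c12 = X.c12 := ⟨rfl, rfl⟩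

/-- … nor the [B13] group (`rfl` ×2) … [cite: Balaban1988RG2Cluster, Lemmas 1–3 pp.9–20 (bookkeeping)] -/
theorem withB8OfRecordSubBH_S13_c13 (X : PrintedCarriersR) (θ : Stage3Params) (lam : ResidB8 θ) :
    (X.withB8OfRecordSubBH θ lam).S13 = X.S13 ∧ (X.withB8OfRecordSubBH θ lam).c13 = X.c13 := ⟨rfl, rfl⟩

/-- … commutes with the [B10] re-binding `withRuns10` (`rfl`) … [cite: Balaban1985UV3, (1)–(5) p.256 (bookkeeping)] -/
theorem withRuns10_withB8OfRecordSubBH (X : PrintedCarriersR) {J : Type} (r : J → B10.RunData) (θ : Stage3Params) (lam : ResidB8 θ) :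
    (X.withRuns10 r).withB8OfRecordSubBH θ lam = (X.withB8OfRecordSubBH θ lam).withRuns10 r := rfl

/-- … with the [B12] substitution `withB12` (`rfl`) … [cite: Balaban1987RG1, Lemma 4 p.280 (bookkeeping)] -/
theorem withB12_withB8OfRecordSubBH (X : PrintedCarriersR) (F12 : B12Sec2to5.Lemma4Frame) (c12 : B12Sec2to5.Lemma4Consts) (θ : Stage3Params) (lam : ResidB8 θ) :
    (X.withB12 F12 c12).withB8OfRecordSubBH θ lam = (X.withB8OfRecordSubBH θ lam).withB12 F12 c12 := rfl

/-- … and passes through the Stage-3 substitutions `carriers₃` (`rfl`). [cite: Balaban1984PropagatorsII, pp.223–250 (bookkeeping)] -/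
theorem carriers₃_withB8OfRecordSubBH (θ₃ : Stage3Params) (X : PrintedCarriersR) (θ : Stage3Params) (lam : ResidB8 θ) :
    carriers₃ θ₃ (X.withB8OfRecordSubBH θ lam) = (carriers₃ θ₃ X).withB8OfRecordSubBH θ lam := rfl

/-- The repaired pin and the old pin substitute THE SAME `GFData2` family `fam8` (`rfl`): only the R-extension field `InR` differs.
[cite: Balaban1985RegularSpaces, (1.33)–(1.40) pp.82–83, (1.146) p.101 (bookkeeping)] -/
theorem withB8OfRecordSubBH_fam8 (X : PrintedCarriersR) (θ : Stage3Params) (lam : ResidB8 θ) :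
    (X.withB8OfRecordSubBH θ lam).fam8 = (X.withB8OfRecordSubB θ lam).fam8 := rfl

/-- Non-vacuity of the pin's index (n05-c's `B8IdxB8LawsB.nonempty_idxB8SubB` BY NAME: genuine `Ω_j = ℤᵈ` members at every depth). [cite: Balaban1985RegularSpaces, p.77 («we admit Ω_j = T_η»)] -/
theorem nonempty_I8b_withB8OfRecordSubBH (X : PrintedCarriersR) (θ : Stage3Params) (lam : ResidB8 θ) : Nonempty (X.withB8OfRecordSubBH θ lam).I8b :=
  B8IdxB8LawsB.nonempty_idxB8SubB θ

end SubIndexBH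

/-! ## §3. THE READING: the repaired leaf = the old pin's eight non-Theorem-8 conjuncts ∧ Theorem 8 surviving at the repaired members; OLD ⇒ NEW; typed ⇒ surviving -/

section Reading

variable {θ : Stage3Params}

/-- **Proposition 7 faithful reads no source**: at the repaired members it IS the old pin's conjunct (`Iff.rfl`: `InA`, (1.140), `InAAx`, `avgClose`, `Cfg`, `Pert` are
`rfl`-equal fields). [cite: Balaban1985RegularSpaces, Prop. 7 (1.144)–(1.145) p.100 (bookkeeping)] -/
theorem prop7PrintedR_famB8OfRecordSubBH_iff (lam : ResidB8 θ) :
    B8SectGH.Prop7PrintedR (fun j : IdxB8SubB θ => famB8OfRecordSubBH θ lam.β lam.len j) (fun j => lam.toAxial j.1) ↔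
      B8SectGH.Prop7PrintedR (fun j : IdxB8SubB θ => famB8OfRecordSubB θ lam.β lam.len j) (fun j => lam.toAxial j.1) :=
  Iff.rfl

/-- **THE READING OF THE REPAIRED SLOT**: `B8LeafOfRecordSubBH θ λ` ⟺ (Lemma 1 ∧ Thm 2 ∧ Prop 3 ∧ Thm 4 ∧ Prop 5 ∃ ∧ Prop 5 ! ∧ Prop 6 ∧ Prop 7 — the old pin's EIGHT
conjuncts, STATED OVER `famB8OfRecordSubB` letter for letter as the knits of record conclude them) ∧ Theorem 8 surviving at γ = 1 AT THE REPAIRED MEMBERS.  Every landed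
supplier of the first eight transfers by `exact`; the ninth is the honest assembly's target (`B8Thm8SurvivingZd3MapH` at `ι := (·.1.1)`).
[cite: Balaban1985RegularSpaces, Lemma 1 p.79, Thm 2 p.83, Prop. 3 p.87, Thm 4 p.88, Prop. 5 p.94, Prop. 6 p.99, Prop. 7 p.100, Thm 8 (1.146) p.101] -/
theorem b8LeafOfRecordSubBH_iff_subB_and_t8H (lam : ResidB8 θ) :
    B8LeafOfRecordSubBH θ lam ↔
      (B8.Lemma1Printed θ.D (blockPairNA θ.D θ.L θ.𝔸) ∧
        B8.Thm2Printed (fun j : IdxB8SubB θ => (famB8OfRecordSubB θ lam.β lam.len j).toGFData) ∧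
        B8.Prop3Printed θ.D (θ.L : ℝ) lam.C₂ lam.inp lam.B₀β (fun j : IdxB8SubB θ => (famB8OfRecordSubB θ lam.β lam.len j).toGFData2) ∧
        B8.Thm4Printed lam.B₁' (fun j : IdxB8SubB θ => (famB8OfRecordSubB θ lam.β lam.len j).toGFData) ∧
        B8.Prop5Exists lam.inp.B₀' lam.B₁ lam.lan ∧ B8.Prop5Unique lam.lan ∧ B8.Prop6Printed θ.D (θ.L : ℝ) lam.B₁ lam.c₁ lam.cub ∧
        B8SectGH.Prop7PrintedR (fun j : IdxB8SubB θ => famB8OfRecordSubB θ lam.β lam.len j) (fun j => lam.toAxial j.1)) ∧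
      B8Thm8Surviving.Thm8SurvivingAt 1 lam.B₁ lam.B₂ (fun j : IdxB8SubB θ => famB8OfRecordSubBH θ lam.β lam.len j) :=
  ⟨fun h => ⟨⟨h.l1, h.t2, h.p3, h.t4, h.p5e, h.p5u, h.p6, (prop7PrintedR_famB8OfRecordSubBH_iff lam).1 h.p7⟩, h.t8⟩,
    fun ⟨⟨h1, h2, h3, h4, h5e, h5u, h6, h7⟩, h8⟩ =>
      { l1 := h1, t2 := h2, p3 := h3, t4 := h4, p5e := h5e, p5u := h5u, p6 := h6, p7 := (prop7PrintedR_famB8OfRecordSubBH_iff lam).2 h7, t8 := h8 }⟩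

/-- **CONSTRUCTOR OF THE REPAIRED SLOT FROM THE OLD PIN'S EIGHT CONJUNCTS AND THEOREM 8 AT THE REPAIRED MEMBERS** (the knit faces' entry point: their landed proofs of
`l1 … p7` over `famB8OfRecordSubB` go in unchanged). [cite: Balaban1985RegularSpaces, Lemma 1 – Prop. 7 pp.79–100, Thm 8 (1.146) p.101] -/
theorem b8LeafOfRecordSubBH_of_subB_fields (lam : ResidB8 θ) (l1 : B8.Lemma1Printed θ.D (blockPairNA θ.D θ.L θ.𝔸))
    (t2 : B8.Thm2Printed (fun j : IdxB8SubB θ => (famB8OfRecordSubB θ lam.β lam.len j).toGFData))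
    (p3 : B8.Prop3Printed θ.D (θ.L : ℝ) lam.C₂ lam.inp lam.B₀β (fun j : IdxB8SubB θ => (famB8OfRecordSubB θ lam.β lam.len j).toGFData2))
    (t4 : B8.Thm4Printed lam.B₁' (fun j : IdxB8SubB θ => (famB8OfRecordSubB θ lam.β lam.len j).toGFData))
    (p5e : B8.Prop5Exists lam.inp.B₀' lam.B₁ lam.lan) (p5u : B8.Prop5Unique lam.lan) (p6 : B8.Prop6Printed θ.D (θ.L : ℝ) lam.B₁ lam.c₁ lam.cub)
    (p7 : B8SectGH.Prop7PrintedR (fun j : IdxB8SubB θ => famB8OfRecordSubB θ lam.β lam.len j) (fun j => lam.toAxial j.1))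
    (t8 : B8Thm8Surviving.Thm8SurvivingAt 1 lam.B₁ lam.B₂ (fun j : IdxB8SubB θ => famB8OfRecordSubBH θ lam.β lam.len j)) :
    B8LeafOfRecordSubBH θ lam :=
  (b8LeafOfRecordSubBH_iff_subB_and_t8H lam).2 ⟨⟨l1, t2, p3, t4, p5e, p5u, p6, p7⟩, t8⟩

/-- **Theorem 8 surviving TRANSFERS OLD ⇒ NEW along the repair** (any γ, B₁, B₂): the repaired membership «f ∈ R(U₀)» is STRONGER (`InR138` is its first clause) and
every other field is `rfl`-equal, so Theorem 8 surviving over the old sub-family implies it over the repaired one; never conversely.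
[cite: Balaban1985RegularSpaces, Thm 8 (1.146) p.101 (bookkeeping: restriction of the source space)] -/
theorem thm8SurvivingAt_famB8OfRecordSubBH_of_subB (γ B₁ B₂ β : ℝ) (len : B7Prop1Explicit.Site θ.D → ℝ)
    (h : B8Thm8Surviving.Thm8SurvivingAt γ B₁ B₂ (fun j : IdxB8SubB θ => famB8OfRecordSubB θ β len j)) :
    B8Thm8Surviving.Thm8SurvivingAt γ B₁ B₂ (fun j : IdxB8SubB θ => famB8OfRecordSubBH θ β len j) := by
  obtain ⟨c₁, hc₁, H⟩ := h
  exact ⟨c₁, hc₁, fun i α₀ α₁ h0 h1 hs U₀ U' f hA hReg hAx hcl hInR hf => H i α₀ α₁ h0 h1 hs U₀ U' f hA hReg hAx hcl hInR.1 hf⟩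

/-- **OLD ⇒ NEW at the slot** (never conversely): the old pin's leaf implies the repaired one — eight conjuncts verbatim, `t8` by
`thm8SurvivingAt_famB8OfRecordSubBH_of_subB`.  Recorded for the lattice of pins; VACUOUS TODAY (the old slot is empty, `B8LeafModelZd3SourceReality.not_b8LeafOfRecordSubB`).
[cite: Balaban1985RegularSpaces, Lemma 1 – Thm 8 pp.79–101 (bookkeeping)] -/
theorem b8LeafOfRecordSubBH_of_b8LeafOfRecordSubB (lam : ResidB8 θ) (h : B8LeafOfRecordSubB θ lam) : B8LeafOfRecordSubBH θ lam :=
  b8LeafOfRecordSubBH_of_subB_fields lam h.l1 h.t2 h.p3 h.t4 h.p5e h.p5u h.p6 h.p7 (thm8SurvivingAt_famB8OfRecordSubBH_of_subB 1 lam.B₁ lam.B₂ lam.β lam.len h.t8)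

/-- **TYPED ⇒ SURVIVING over the repaired sub-family** (`B8LeafKnitRS.b8LeafRS_of_b8LeafR` under `C136_C162_famB8OfRecordSubBH`): the leaf AS TYPED (`DagBinding.B8LeafR`,
`t8 :=` Thm 8 printed at γ = 1) over the repaired group implies `B8LeafOfRecordSubBH`; never conversely.
[cite: Balaban1985RegularSpaces, Thm 8 p.101 + (1.36) p.82 + (1.62) p.87 (bookkeeping)] -/
theorem b8LeafOfRecordSubBH_of_b8LeafR (lam : ResidB8 θ)
    (h : B8LeafR θ.D (θ.L : ℝ) lam.C₂ lam.B₁' lam.inp.B₀' lam.B₁ lam.B₂ lam.c₁ lam.inp lam.B₀β (blockPairNA θ.D θ.L θ.𝔸)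
      (fun j : IdxB8SubB θ => famB8OfRecordSubBH θ lam.β lam.len j) lam.lan lam.cub (fun j => lam.toAxial j.1)) :
    B8LeafOfRecordSubBH θ lam :=
  B8LeafKnitRS.b8LeafRS_of_b8LeafR (C136_C162_famB8OfRecordSubBH lam.β lam.len) h

/-- The Theorem-8 conjunct of the repaired slot, projected (the target the honest assembly `B8Thm8SurvivingZd3MapH` supplies at `ι := (·.1.1)`).
[cite: Balaban1985RegularSpaces, Thm 8 (1.146) p.101] -/
theorem B8LeafOfRecordSubBH.t8H {lam : ResidB8 θ} (h : B8LeafOfRecordSubBH θ lam) :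
    B8Thm8Surviving.Thm8SurvivingAt 1 lam.B₁ lam.B₂ (fun j : IdxB8SubB θ => zdGF3H θ.𝔸 θ.L lam.β lam.len j.1.1) :=
  h.t8

end Reading

/-! ## §4. The CUT residual layer (dag-n05-d's `ResidB8.cutSubB`, reused): the repaired slot there reads the knits' conclusion with `t8` at the repaired members -/

section CutLayerH

variable {θ : Stage3Params}

/-- **THE REPAIRED SLOT AT THE CUT LAYER READS THE KNITS' CONCLUSION LETTER FOR LETTER** (`Iff.rfl`): `B8LeafOfRecordSubBH θ (λ.cutSubB J lan c₁)` is the surviving leaf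
over `famB8OfRecordSubBH θ λ.β λ.len`, Prop. 5 at `lan`, Prop. 6 at `fun j : IdxB8SubB θ => cubB8OfRecord θ j.1`, the axial map through `·.1`, threshold `c₁`.
[cite: Balaban1985RegularSpaces, Lemma 1 – Thm 8 pp.79–101 (bookkeeping)] -/
theorem b8LeafOfRecordSubBH_cutSubB_iff (lam : ResidB8 θ) (J : Type) (lan : J → B8.LandauData) (c₁ : ℝ) :
    B8LeafOfRecordSubBH θ (lam.cutSubB J lan c₁) ↔
      B8LeafRS θ.D (θ.L : ℝ) lam.C₂ lam.B₁' lam.inp.B₀' lam.B₁ lam.B₂ c₁ lam.inp lam.B₀β (blockPairNA θ.D θ.L θ.𝔸)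
        (fun j : IdxB8SubB θ => famB8OfRecordSubBH θ lam.β lam.len j) lan (fun j : IdxB8SubB θ => cubB8OfRecord θ j.1) (fun j => lam.toAxial j.1) :=
  Iff.rfl

/-- **THE REPAIRED SLOT AT THE CUT LAYER, READ**: the old cut slot's eight non-Theorem-8 conjuncts (over `famB8OfRecordSubB`, Prop. 5 at `lan`, Prop. 6 at the law-cut
cubes, threshold `c₁`) ∧ Theorem 8 surviving at the repaired members with constants `λ.B₁, λ.B₂` (`b8LeafOfRecordSubBH_iff_subB_and_t8H` at the cut layer; the cut does
not touch `β, len, B₁, B₂`). [cite: Balaban1985RegularSpaces, Lemma 1 – Thm 8 pp.79–101 (bookkeeping)] -/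
theorem b8LeafOfRecordSubBH_cutSubB_iff_subB_and_t8H (lam : ResidB8 θ) (J : Type) (lan : J → B8.LandauData) (c₁ : ℝ) :
    B8LeafOfRecordSubBH θ (lam.cutSubB J lan c₁) ↔
      (B8.Lemma1Printed θ.D (blockPairNA θ.D θ.L θ.𝔸) ∧
        B8.Thm2Printed (fun j : IdxB8SubB θ => (famB8OfRecordSubB θ lam.β lam.len j).toGFData) ∧
        B8.Prop3Printed θ.D (θ.L : ℝ) lam.C₂ lam.inp lam.B₀β (fun j : IdxB8SubB θ => (famB8OfRecordSubB θ lam.β lam.len j).toGFData2) ∧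
        B8.Thm4Printed lam.B₁' (fun j : IdxB8SubB θ => (famB8OfRecordSubB θ lam.β lam.len j).toGFData) ∧
        B8.Prop5Exists lam.inp.B₀' lam.B₁ lan ∧ B8.Prop5Unique lan ∧
        B8.Prop6Printed θ.D (θ.L : ℝ) lam.B₁ c₁ (fun j : IdxB8SubB θ => cubB8OfRecord θ j.1) ∧
        B8SectGH.Prop7PrintedR (fun j : IdxB8SubB θ => famB8OfRecordSubB θ lam.β lam.len j) (fun j => lam.toAxial j.1)) ∧
      B8Thm8Surviving.Thm8SurvivingAt 1 lam.B₁ lam.B₂ (fun j : IdxB8SubB θ => famB8OfRecordSubBH θ lam.β lam.len j) :=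
  b8LeafOfRecordSubBH_iff_subB_and_t8H (lam.cutSubB J lan c₁)

end CutLayerH

/-! ## §5. Non-vacuity of the repair AT THE PIN: the refuting sources of record are rejected at every member; `f = 0` is admitted -/

section RejectedAtPin

variable {θ : Stage3Params}

/-- **A source with a non-Hermitian value is NOT admitted at any member of the repaired pin** — so p501857's witness `f := Δ^η_1(I•λ₀)` (values `I•κ•1`, `κ ≠ 0`),
which empties the OLD slot, is not a Theorem-8 datum of the repaired one. [cite: Balaban1985RegularSpaces, Thm 8 (1.146) p.101 («𝔤-valued»)] -/
theorem not_inR_famB8OfRecordSubBH_of_not_isSelfAdjoint (β : ℝ) (len : B7Prop1Explicit.Site θ.D → ℝ) (i : IdxB8SubB θ)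
    (U₀ : (famB8OfRecordSubBH θ β len i).Cfg) {f : B7Prop1Explicit.Site θ.D → θ.𝔸} {x : B7Prop1Explicit.Site θ.D} (hx : ¬ IsSelfAdjoint (f x)) :
    ¬ (famB8OfRecordSubBH θ β len i).InR U₀ f :=
  B8LeafModelZd3H.not_inR_zdGF3H_of_not_isSelfAdjoint i.1.1 U₀ hx

/-- **An unbounded source is NOT admitted at any member of the repaired pin** — so p503878's Hermitian dipole train `λ_∞` (junk norm `0`), which defeats the OLD slot's
body, is not a Theorem-8 datum of the repaired one. [cite: Balaban1985RegularSpaces, p.86 (definition after (1.55))] -/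
theorem not_inR_famB8OfRecordSubBH_of_not_bdd (β : ℝ) (len : B7Prop1Explicit.Site θ.D → ℝ) (i : IdxB8SubB θ) (U₀ : (famB8OfRecordSubBH θ β len i).Cfg)
    {f : B7Prop1Explicit.Site θ.D → θ.𝔸} (hf : ¬ B8ScaledSupNorm.Bdd θ.L i.1.1.k i.1.1.η (-(2 : ℝ)) (fun j (x : B7Prop1Explicit.Site θ.D) => x ∈ i.1.1.Ω j) f) :
    ¬ (famB8OfRecordSubBH θ β len i).InR U₀ f :=
  B8LeafModelZd3H.not_inR_zdGF3H_of_not_bdd i.1.1 U₀ hf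

/-- **An admitted source at a member of the repaired pin has a bounded weighted family** (so its `|f|₍₋₂₎` is the true supremum).
[cite: Balaban1985RegularSpaces, p.86 (definition after (1.55))] -/
theorem bdd_of_inR_famB8OfRecordSubBH (β : ℝ) (len : B7Prop1Explicit.Site θ.D → ℝ) (i : IdxB8SubB θ) (U₀ : (famB8OfRecordSubBH θ β len i).Cfg)
    {f : B7Prop1Explicit.Site θ.D → θ.𝔸} (h : (famB8OfRecordSubBH θ β len i).InR U₀ f) :
    B8ScaledSupNorm.Bdd θ.L i.1.1.k i.1.1.η (-(2 : ℝ)) (fun j (x : B7Prop1Explicit.Site θ.D) => x ∈ i.1.1.Ω j) f :=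
  B8LeafModelZd3H.bdd_of_inR_zdGF3H i.1.1 U₀ h

/-- **An admitted source at a member of the repaired pin is Hermitian-valued**. [cite: Balaban1985RegularSpaces, Thm 8 (1.146) p.101 («𝔤-valued»)] -/
theorem isSelfAdjoint_of_inR_famB8OfRecordSubBH (β : ℝ) (len : B7Prop1Explicit.Site θ.D → ℝ) (i : IdxB8SubB θ) (U₀ : (famB8OfRecordSubBH θ β len i).Cfg)
    {f : B7Prop1Explicit.Site θ.D → θ.𝔸} (h : (famB8OfRecordSubBH θ β len i).InR U₀ f) (x : B7Prop1Explicit.Site θ.D) : IsSelfAdjoint (f x) :=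
  h.2.1 x

/-- **Non-vacuity of the repaired membership at the pin: `f = 0 ∈ R(U₀)`** at every member and every `U₀` (so the Theorem-8 binder of `B8LeafOfRecordSubBH` is not emptied
by the repair; at `f = 0` (1.146) is (1.38)). [cite: Balaban1985RegularSpaces, (1.146) p.101, (1.38) p.82] -/
theorem inR_famB8OfRecordSubBH_zero (β : ℝ) (len : B7Prop1Explicit.Site θ.D → ℝ) (i : IdxB8SubB θ) (U₀ : (famB8OfRecordSubBH θ β len i).Cfg) :
    (famB8OfRecordSubBH θ β len i).InR U₀ (0 : B7Prop1Explicit.Site θ.D → θ.𝔸) :=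
  B8LeafModelZd3H.inR_zdGF3H_zero i.1.1 U₀

end RejectedAtPin

#print axioms b8LeafOfRecordSubBH_iff_subB_and_t8H
#print axioms b8LeafOfRecordSubBH_of_b8LeafOfRecordSubB

end Literature.MathematicalPhysics.QuantumFieldTheory.Balaban1983to89.Node00

end
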